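import Literature.AlgebraicGeometry.Resolution.RelativeCurveLevelReduction
import Literature.AlgebraicGeometry.Resolution.RelativeCurveAmbientHypotheses
import Literature.AlgebraicGeometry.Resolution.HenselizationHenselian
import Literature.AlgebraicGeometry.Resolution.InseparableLocalUniformizationHeightStepTwo
import Mathlib.FieldTheory.IsAlgClosed.AlgebraicClosure
import HarnessLib

/-!
# Temkin's Thm. 3.3.1 (smooth-fibre case): the assembly from its two inputs

Topic: `Literature/AlgebraicGeometry/Resolution`. M. Temkin, *Inseparable local uniformization*,
J. Algebra 373 (2013) 65–119 = arXiv:0804.1554v3, Thm. 3.3.1 for `k`-smooth generic fibres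
(tree: the named fact `Temkin2013RelativeCurveSmoothFibre`,
`InseparableLocalUniformizationCurvesStepOne.lean`, the last leaf of `Temkin2013`). The
algebraic proof assembled in the tree has two inputs, both stated here as explicit HYPOTHESES
(inline propositions, not named facts) and both being proved in companion files:

* **(J1) the valuative input at a finite level** (Temkin, Thms. 3.2.3, 3.2.4, 3.2.6 read in
  henselizations, cf. the reading notes of `DeeplyRamifiedKrasner.lean`; in residue
  characteristic `0` it is `RelativeCurveConstantsCharZero.lean`; the descent to a finite level
  is `ValuativeDatumFiniteLevel.lean`): for a rank-one equicharacteristic `(Ω, V) ⊇ K₁ ⊇ k`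
  with `K₁|k` a separably generated function field of transcendence degree one, `|K₁^×|/|k^×|`
  torsion and `K̃₁/k̃` algebraic, there are finite sets `S` (purely inseparable over `k`) and
  `Y` (separable over `k(S)`, inside `(K₁·k(S))^h`) and `t ∈ K₁·k(S) ∩ O_V` transcendental over
  `k` with `K₁ ≤ k(S, Y)(t)^h`;
* **(J2) the algebraization** (Temkin, proof of Thm. 3.3.1, Steps 2–4, with `l = k`: the common
  smooth roof built from the Hensel chart over the normalized `K`-rational model and the
  standard-étale chart over `m°[t]`, `RelativeCurveChartSetup.lean`, `DChart*.lean`,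
  `EChart.lean`, `RoofInField.lean`): the conclusion of Thm. 3.3.1 for data `(k, K, L₁)`
  satisfying the hypotheses of the fact, given finitely many `k`-separable constants `Y` in the
  henselization of `L₁` inside an ambient `(Ω, V) ⊇ (L₁, L₁°)` and `x ∈ L₁°` transcendental over
  `k` with `L₁ ≤ k(Y)(x)^h`.

Main result: `Temkin2013RelativeCurveSmoothFibre.of_inputs : (J1) → (J2) → Temkin2013RelativeCurveSmoothFibre`,
PROVED: embed into `Ω = \overline{K₁}` with a Chevalley extension `V` of `K₁°`
(`exists_valuationSubring_comap_eq`); transport the hypotheses (`smoothFibre_ambient_hypotheses`,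
`RelativeCurveAmbientHypotheses.lean`); apply (J1); pass to a finite purely inseparable level
`lvl ⊇ S` with the level data of `exists_smoothFibre_level` (`RelativeCurveLevelReduction.lean`,
Temkin's Step 1), over which `Y` is `l₀`-separable (`isSeparable_of_subfield_le_range`) and `t`
still transcendental; apply (J2) to the level data; descend the conclusion (Step 1, included in
`exists_smoothFibre_level`).

No definitions, no named facts. The two hypotheses are the precise statements whose proofs
close `Temkin2013RelativeCurveSmoothFibre`.

## Sources

* M. Temkin, arXiv:0804.1554v3, Thm. 3.3.1 and its proof, Steps 1–4 (pp. 44–45); Thms. 3.2.3,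
  3.2.4, 3.2.6 (pp. 41–43). [Temkin2013]
-/

noncomputable section

open IsLocalRing

namespace Literature.AlgebraicGeometry.Resolution

universe u

/-! ### Bookkeeping -/

section Bookkeeping

variable {Ω : Type u} [Field Ω]

/-- Separability over a subfield contained in the image of a field `l₀ → Ω` implies
separability over `l₀`. [folklore] -/
theorem isSeparable_of_subfield_le_range (l₀ : Type u) [Field l₀] [Algebra l₀ Ω]
    (E : Subfield Ω) (hE : (E : Set Ω) ⊆ Set.range (algebraMap l₀ Ω)) {y : Ω}
    (hy : IsSeparable E y) : IsSeparable l₀ y := by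
  classical
  have hinj : Function.Injective (algebraMap l₀ Ω) := (algebraMap l₀ Ω).injective
  let f : E →+* l₀ :=
    { toFun := fun x => (hE x.2).choose
      map_one' := hinj (by rw [(hE E.one_mem).choose_spec]; simp)
      map_mul' := fun a b => hinj (by
        rw [map_mul, (hE (mul_mem a.2 b.2)).choose_spec, (hE a.2).choose_spec,
          (hE b.2).choose_spec])
      map_zero' := hinj (by rw [(hE E.zero_mem).choose_spec]; simp)
      map_add' := fun a b => hinj (by
        rw [map_add, (hE (add_mem a.2 b.2)).choose_spec, (hE a.2).choose_spec,
          (hE b.2).choose_spec]) }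
  have hcomp : (algebraMap l₀ Ω).comp f = algebraMap E Ω :=
    RingHom.ext fun x => (hE x.2).choose_spec
  exact isSeparable_of_ringHom_comp_eq f hcomp hy

/-- Algebraicity over a field `l₀ → Ω` passes to its image subfield. [folklore] -/
theorem isAlgebraic_subfield_of_range_eq (l₀ : Type u) [Field l₀] [Algebra l₀ Ω]
    (E : Subfield Ω) (hE : Set.range (algebraMap l₀ Ω) = (E : Set Ω)) {y : Ω}
    (hy : IsAlgebraic l₀ y) : IsAlgebraic E y := by
  let f : l₀ →+* E := (algebraMap l₀ Ω).codRestrict E fun c => by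
    rw [← SetLike.mem_coe, ← hE]; exact ⟨c, rfl⟩
  have hf : Function.Injective f := fun a b hab =>
    (algebraMap l₀ Ω).injective (congrArg Subtype.val hab)
  exact hy.ringHom_of_comp_eq f (RingHom.id Ω) hf (by ext c; rfl)

end Bookkeeping

/-! ### The assembly -/

set_option maxHeartbeats 1600000 in
set_option synthInstance.maxHeartbeats 80000 in
/-- **Thm. 3.3.1 (smooth-fibre case) from its valuative input (J1) and its algebraization
(J2).** See the module docstring for (J1), (J2) and the proof.
[cite: Temkin2013, Thm. 3.3.1 (proof, Steps 1–4) with Thms. 3.2.3, 3.2.4, 3.2.6] -/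
theorem Temkin2013RelativeCurveSmoothFibre.of_inputs
    (hJ1 : ∀ (Ω : Type u) [Field Ω] [IsAlgClosed Ω] (V : ValuationSubring Ω) (k K₁ : Subfield Ω),
      k ≤ K₁ → IsRankOneValued V k → ringExpChar (ResidueField V) = ringExpChar Ω →
      FGOver k K₁ → SeparablyGeneratedOver k K₁ →
      (∃ t ∈ K₁, Transcendental k t ∧
        ∀ z ∈ K₁, IsAlgebraic (IntermediateField.adjoin k ({t} : Set Ω)) z) →
      IsValueTorsionOver V k K₁ → IsResiduallyAlgebraicOver V k K₁ →
      ∃ (S Y : Finset Ω) (t : Ω), (∀ s ∈ S, ∃ n : ℕ, s ^ (ringExpChar Ω) ^ n ∈ k) ∧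
        (∀ y ∈ Y, IsSeparable (Subfield.closure ((k : Set Ω) ∪ ↑S)) y) ∧
        t ∈ K₁ ⊔ Subfield.closure ((k : Set Ω) ∪ ↑S) ∧ t ∈ V ∧ Transcendental k t ∧
        (↑Y : Set Ω) ⊆ henselization V (K₁ ⊔ Subfield.closure ((k : Set Ω) ∪ ↑S)) ∧
        K₁ ≤ henselization V (Subfield.closure ((k : Set Ω) ∪ ↑S ∪ ↑Y ∪ {t})))
    (hJ2 : ∀ (k K : Type u) [Field k] [Field K] [Algebra k K]
      (Ok : ValuationSubring k) (O : ValuationSubring K),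
      ringChar (ResidueField Ok) = ringChar k →
      O.comap (algebraMap k K) = Ok → ringKrullDim Ok = 1 → ringKrullDim O = 1 →
      (⊤ : IntermediateField k K).FG → Algebra.trdeg k K = 1 →
      IsValueTorsionOver O (algebraMap k K).fieldRange ⊤ →
      IsResiduallyAlgebraicOver O (algebraMap k K).fieldRange ⊤ →
      ∀ A : Subring K, IsAffineNormalizedModel O (Ok.toSubring.map (algebraMap k K)) A →
      Algebra.Smooth k (Algebra.adjoin k (A : Set K)) →
      ∀ (L₁ : Type u) [Field L₁] [Algebra K L₁] [Algebra k L₁] [IsScalarTower k K L₁],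
      FiniteDimensional K L₁ →
      ∀ O₁ : ValuationSubring L₁, O₁.comap (algebraMap K L₁) = O →
      Algebra.Smooth k (Algebra.adjoin k (nrIn (A.map (algebraMap K L₁)) : Set L₁)) →
      ∀ (Ω : Type u) [Field Ω] [IsAlgClosed Ω] [Algebra L₁ Ω] [Algebra K Ω] [Algebra k Ω]
        [IsScalarTower K L₁ Ω] [IsScalarTower k L₁ Ω] [IsScalarTower k K Ω]
        (V : ValuationSubring Ω), V.comap (algebraMap L₁ Ω) = O₁ →
      ∀ (Y : Finset Ω), (∀ y ∈ Y, IsSeparable k y) →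
        (↑Y : Set Ω) ⊆ henselization V (algebraMap L₁ Ω).fieldRange →
      ∀ x : L₁, x ∈ O₁ → Transcendental k (algebraMap L₁ Ω x) →
        (algebraMap L₁ Ω).fieldRange ≤ henselization V
          (Subfield.closure (Set.range (algebraMap k Ω) ∪ ↑Y ∪ {algebraMap L₁ Ω x})) →
      Temkin2013RelativeCurveConclusion k K Ok O A L₁ O₁) :
    Temkin2013RelativeCurveSmoothFibre.{u} := by
  intro k K _ _ _ Ok O hchar hOk hdimk hdimK hfg htr hvt hra A hA hsm K₁ _ _ _ _ hK₁fin O₁ hO₁ hsm₁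
  classical
  haveI := hK₁fin
  ------------------------------------------------------------------
  -- ### the ambient valued field `(Ω, V) = (\overline{K₁}, V ⊇ K₁°)`
  ------------------------------------------------------------------
  let Ω : Type u := AlgebraicClosure K₁
  obtain ⟨V, hV⟩ := exists_valuationSubring_comap_eq (Ω := Ω) O₁
  haveI : IsScalarTower k K Ω := IsScalarTower.of_algebraMap_eq fun c => by
    rw [IsScalarTower.algebraMap_apply k K₁ Ω, IsScalarTower.algebraMap_apply k K K₁,
      ← IsScalarTower.algebraMap_apply K K₁ Ω]
  -- the hypotheses in the ambient rendering
  obtain ⟨hle, hFG, hVT, hRA, hr1k, -, hSG, hchΩ, htΩ⟩ :=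
    smoothFibre_ambient_hypotheses k K Ok O hchar hOk hdimk hdimK hfg htr hvt hra A hA K₁ O₁ hO₁
      hsm₁ Ω V hV
  ------------------------------------------------------------------
  -- ### (J1): the finite-level valuative datum
  ------------------------------------------------------------------
  obtain ⟨S, Y, t, hSpi, hYsep, htK, htV, httr, hYh, hgen⟩ :=
    hJ1 Ω V (algebraMap k Ω).fieldRange (algebraMap K₁ Ω).fieldRange hle hr1k hchΩ hFG hSG htΩ
      hVT hRA
  -- `S` lies in the perfect closure of `k`
  have hSpc : (↑S : Set Ω) ⊆ perfectClosure k Ω := by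
    intro s hs
    obtain ⟨n, hn⟩ := hSpi s hs
    haveI : ExpChar k (ringExpChar k) := inferInstance
    haveI : ExpChar Ω (ringExpChar k) :=
      expChar_of_injective_algebraMap (algebraMap k Ω).injective (ringExpChar k)
    have hq : ringExpChar Ω = ringExpChar k := ringExpChar.eq Ω (ringExpChar k)
    rw [hq] at hn
    exact (mem_perfectClosure_iff_pow_mem (ringExpChar k)).mpr ⟨n, hn⟩
  ------------------------------------------------------------------
  -- ### the level data (Step 1)
  ------------------------------------------------------------------
  obtain ⟨lvl, hSlvl, hlvlk, hlvlfin, FE, FE₁, hFE, hFE₁, hFEle, iKFE, iTk, iK₁FE₁, iTk₁, iKFE₁,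
    iT₁, hψ, hψ₁, hTfin, hFfin, hFpi, hF₁fin, hF₁pi, l₀, hl₀mem, hl₀fin, hl₀pi, hFgen, hF₁gen,
    A_F, hAA_F, hrest⟩ :=
    exists_smoothFibre_level k K Ok O hchar hOk hdimk hdimK hfg htr hvt hra A hA K₁ O₁ hO₁ Ω V hV
      S hSpc
  letI := iKFE; letI := iK₁FE₁; letI := iKFE₁
  haveI := iTk; haveI := iTk₁; haveI := iT₁
  letI iFF₁ : Algebra FE FE₁ := (IntermediateField.inclusion hFEle).toRingHom.toAlgebra
  obtain ⟨iT₂, h10⟩ := hTfin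
  haveI := iT₂; haveI := h10; haveI := hFfin; haveI := hFpi; haveI := hF₁fin; haveI := hF₁pi
  haveI := hl₀fin; haveI := hl₀pi
  obtain ⟨hO_F₁K₁, hO_FK, hO_Feq, hOk', h1, h3, h4, h5, h6, h7, h8, h9, hsmF, hsmF₁, htransport⟩ :=
    hrest
  -- instances towards `Ω`
  haveI : IsScalarTower FE FE₁ Ω := IsScalarTower.of_algebraMap_eq fun _ => rfl
  haveI : IsScalarTower l₀ FE₁ Ω := IsScalarTower.of_algebraMap_eq fun _ => rfl
  haveI : IsScalarTower l₀ FE Ω := IsScalarTower.of_algebraMap_eq fun _ => rfl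
  -- the image of `l₀` in `Ω` is `lvl`
  have hl₀range : Set.range (algebraMap l₀ Ω) = (lvl : Set Ω) := by
    ext z
    constructor
    · rintro ⟨c, rfl⟩
      exact (hl₀mem (c : FE)).mp c.2
    · intro hz
      have hzFE : z ∈ FE := by
        rw [hFE]; exact (le_sup_right : lvl ≤ _ ⊔ lvl) hz
      exact ⟨⟨⟨z, hzFE⟩, (hl₀mem _).mpr hz⟩, rfl⟩
  -- `kΩ ∪ S ⊆ lvl`, so `k(S) ≤ lvl`
  have hkS_lvl : Subfield.closure (((algebraMap k Ω).fieldRange : Set Ω) ∪ ↑S) ≤ lvl.toSubfield := by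
    refine Subfield.closure_le.mpr (Set.union_subset ?_ hSlvl)
    rintro _ ⟨c, rfl⟩
    exact lvl.algebraMap_mem c
  -- the range of `F₁ = K₁·lvl` in `Ω`
  have hF₁range : (algebraMap FE₁ Ω).fieldRange = FE₁.toSubfield :=
    fieldRange_algebraMap_intermediateField FE₁
  have hK₁FE₁ : (algebraMap K₁ Ω).fieldRange ≤ FE₁.toSubfield := by
    rintro _ ⟨z, rfl⟩
    rw [hFE₁]
    exact (le_sup_left : (IsScalarTower.toAlgHom k K₁ Ω).fieldRange ≤ _) ⟨z, rfl⟩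
  have hlvlFE₁ : lvl ≤ FE₁ := by rw [hFE₁]; exact le_sup_right
  ------------------------------------------------------------------
  -- ### the hypotheses of (J2) for the level data
  ------------------------------------------------------------------
  -- the constants are separable over `l₀`
  have hYsep' : ∀ y ∈ Y, IsSeparable l₀ y := fun y hy =>
    isSeparable_of_subfield_le_range l₀ _ (fun z hz => by
      rw [hl₀range]; exact hkS_lvl hz) (hYsep y hy)
  -- the constants lie in the henselization of `F₁`
  have hYh' : (↑Y : Set Ω) ⊆ henselization V (algebraMap FE₁ Ω).fieldRange := by
    rw [hF₁range]
    refine hYh.trans (henselization_mono V Kuhlmann2010HenselizationIsHenselian_holds.{u} ?_)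
    exact sup_le hK₁FE₁ (hkS_lvl.trans fun z hz => hlvlFE₁ hz)
  -- the generator `t` as an element of `F₁°`
  have htFE₁ : t ∈ FE₁ := by
    have : (algebraMap K₁ Ω).fieldRange ⊔ Subfield.closure
        (((algebraMap k Ω).fieldRange : Set Ω) ∪ ↑S) ≤ FE₁.toSubfield :=
      sup_le hK₁FE₁ (hkS_lvl.trans fun z hz => hlvlFE₁ hz)
    exact this htK
  let x : FE₁ := ⟨t, htFE₁⟩
  have hxΩ : algebraMap FE₁ Ω x = t := rfl
  have hxO : x ∈ V.comap (algebraMap FE₁ Ω) := htV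
  -- `t` is transcendental over `l₀`
  have hxtr : Transcendental l₀ (algebraMap FE₁ Ω x) := by
    rw [hxΩ]
    intro halg
    apply httr
    -- algebraic over `l₀` ⇒ over `lvl` ⇒ over `kΩ` (`lvl` is algebraic over `k`)
    have h1' : IsAlgebraic lvl.toSubfield t :=
      isAlgebraic_subfield_of_range_eq l₀ lvl.toSubfield hl₀range halg
    have hlvlalg : ∀ w ∈ lvl.toSubfield, IsAlgebraic (algebraMap k Ω).fieldRange w := by
      intro w hw
      haveI : Algebra.IsIntegral k (perfectClosure k Ω) := IsPurelyInseparable.isIntegral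
      have hw' : IsAlgebraic k w :=
        ((Algebra.IsIntegral.isIntegral (R := k) (⟨w, hlvlk hw⟩ : perfectClosure k Ω)).map
          (IntermediateField.val _)).isAlgebraic
      exact hw'.ringHom_of_comp_eq (algebraMap k Ω).rangeRestrictField (RingHom.id Ω)
        (algebraMap k Ω).rangeRestrictField_bijective.1 (by ext; rfl)
    have hkl : (algebraMap k Ω).fieldRange ≤ lvl.toSubfield := by
      rintro _ ⟨c, rfl⟩; exact lvl.algebraMap_mem c
    exact isAlgebraic_trans_subfield hkl hlvlalg h1'
  -- the E-side inclusion `F₁ ≤ l₀(Y)(t)^h`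
  have hE : (algebraMap FE₁ Ω).fieldRange ≤ henselization V
      (Subfield.closure (Set.range (algebraMap l₀ Ω) ∪ ↑Y ∪ {algebraMap FE₁ Ω x})) := by
    rw [hF₁range, hxΩ, hl₀range]
    have hFE₁eq : FE₁.toSubfield = (algebraMap K₁ Ω).fieldRange ⊔ lvl.toSubfield := by
      apply le_antisymm
      · intro z hz
        rw [hFE₁] at hz
        -- `z ∈ χ₁.fieldRange ⊔ lvl` as intermediate fields
        have : (IsScalarTower.toAlgHom k K₁ Ω).fieldRange ⊔ lvl ≤
            ((algebraMap K₁ Ω).fieldRange ⊔ lvl.toSubfield).toIntermediateField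
              (fun c => (le_sup_right : lvl.toSubfield ≤ _) (lvl.algebraMap_mem c)) := by
          refine sup_le ?_ ?_
          · rintro _ ⟨w, rfl⟩
            exact (le_sup_left : (algebraMap K₁ Ω).fieldRange ≤ _) ⟨w, rfl⟩
          · intro w hw
            exact (le_sup_right : lvl.toSubfield ≤ _) hw
        exact this hz
      · exact sup_le hK₁FE₁ fun z hz => hlvlFE₁ hz
    rw [hFE₁eq]
    refine sup_le ?_ ?_
    · refine hgen.trans (henselization_mono V Kuhlmann2010HenselizationIsHenselian_holds.{u}
        (Subfield.closure_mono ?_))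
      refine Set.union_subset_union_left _ (Set.union_subset_union_left _ ?_)
      intro z hz
      exact hkS_lvl (Subfield.subset_closure hz)
    · intro z hz
      exact le_henselization V _ (Subfield.subset_closure (Or.inl (Or.inl hz)))
  ------------------------------------------------------------------
  -- ### (J2) for the level data, and the descent of the conclusion
  ------------------------------------------------------------------
  have hconc : Temkin2013RelativeCurveConclusion l₀ FE
      (((V.comap (algebraMap FE₁ Ω)).comap (algebraMap FE FE₁)).comap (algebraMap l₀ FE))
      ((V.comap (algebraMap FE₁ Ω)).comap (algebraMap FE FE₁)) A_F FE₁
      (V.comap (algebraMap FE₁ Ω)) :=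
    hJ2 l₀ FE _ _ h1 rfl h3 h4 h5 h6 h7 h8 A_F h9 hsmF FE₁ h10 _ rfl hsmF₁ Ω V rfl Y hYsep' hYh'
      x hxO hxtr hE
  exact htransport hconc

end Literature.AlgebraicGeometry.Resolution

end
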